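/-
Copyright (c) 2026.  Released under the Apache 2.0 license of this project.
Cell decomp-a2c, lens 4 (minimal-counterexample / extremal reduction), generation 70 — the FAR LAYERS of both window sums
of leaf Z2 IN CLOSED FORM on the pinned Gram chart.
-/
import Summits.AtomisticToContinuum.Crystallization.Theorems.OverbindingBudgetAffineFarWindow
import Summits.AtomisticToContinuum.Crystallization.Theorems.OverbindingBudgetAffineRadialChart

/-!
(SPLIT FOR THE 400-LINE CAP by the landing lane, hand-2 g33: this file = part 1 of 2; sequels `…OverbindingBudgetAffineFarLayerMain` import it in a chain; same namespace, all FQNs unchanged.)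
# The far layers `|k| ≥ 4` of `s⁶·T₃↑` and `s¹²·T₆↓` are ONE explicit algebraic function of the Gram chart point
# (decomp-a2c lens-4, generation 70 «FarLayerMainTerms»: critic row 1246, open question (J3) — the far field IS functional in `y`, in closed form)

Leaf Z2 = `FarCoreExcess (1/25) (1/2000) (1/(2·10⁷))` is decided per sign window by the ratio table `b·T₃↑² ≤ T₆↓`
(`…FarCoreWindowsB`), modelled on the pinned Gram chart `y = gramChart X ∈ E5` (`…RadialChart`) by finite near families plus FAR
FIELDS.  Generations 67/68 used CONSTANT far fields, generation 69 a quadratic far-field JET whose majorisation of the far part was left as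
a numerical certificate over an infinite lattice sum (critic row 1246: (upper-J) CERT·ATTACKABLE-M; open question (J3): does the uniform
far enclosure expose the cell area `A(y)` and the layer height `d(y)` FUNCTIONALLY?).  It does, and in closed form:

* the tree's uniform far enclosure (`…FarWindow.windowSixUp_le_near_add_far` / `near_add_far_le_windowTwelveLo`, dual-Bessel rows
  `…DualBesselKernel.DualRow`) bounds the far layers of `T₃↑(w, B)` by `2·(π/(2√D₁·δ₁⁴)·Z₄' + remainder)` for ANY brackets
  `δ₁ ≤ height(B)`, `D₁ ≤ planar Gram det(B) ≤ D₂` (and the twelve side from below);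
* apply it to the SCALE-NORMALISED map `X̂ = (chartScale X)⁻¹ • X` (§3) with the EXACT values: the planar Gram determinant of `X̂` IS
  `det G_∥(y) = (1 + y₂) − (½ + y₀)² =: detPar y`, and `height(X̂)² · det G_∥(y) = det G(y) =: detFull y` (the determinant of the chart
  matrix `gramOfChart y`; ★ `heightSq_unit_mul_detPar`, from the folklore identity ★ `heightSq_mul_gramDet₂`:
  `dist(z, span{u,v})² · Gram₂(u,v) = Gram₃(u,v,z)` for any three vectors of `E3`);
* homogeneity `T₃↑(w, c•X) = c⁻⁶·T₃↑(w, X)`, `T₆↓(w, c•X) = c⁻¹²·T₆↓(w, X)` (§2) moves the power of `chartScale X` across.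

RESULT (§4).  With `M₆(y) := π·Z₄'·detPar y² / (√(detPar y)·detFull y²)` (`= π·Z₄'·q^{3/2}/c²`, `Z₄' = π⁴/90 − 1393/1296 = Σ_{m≥4} m⁻⁴`,
★ `hasSum_zetaFourTail`, twenty-digit enclosure `zetaFourTail_mem_Icc`) and `M₁₂(N, y) := (2π/5)·T_N·detPar y⁵ / (√(detPar y)·detFull y⁵)`
(`T_N = Σ_{m<N} (m+4)^{−10}`, any truncation `N`):
  ★★ `far_six_le_farMainSix`:        `chartScale X⁶ · (T₃↑(w,X) − Σ_{|k|≤3} layerSum X 6 k ℓ_k) ≤ M₆(gramChart X) + 2(π/√Dlo)·bound/(1 − Q)`,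
  ★★ `farMainTwelve_le_far_twelve`:  `M₁₂(N, gramChart X) − 2(π/(60√Dlo))·bound/(1 − Q) ≤ chartScale X¹² · (T₆↓(w,X) − Σ_{|k|≤3} layerSum X 12 k ℓ_k)`,
for ONE certified row per exponent (`R.check = true`: decidable) on a box of the NORMALISED planar entries `(g₀₀, g₀₁, g₁₁) = (1, ½ + y₀, 1 + y₂)`
and a height floor `δlo² · detPar y ≤ detFull y` (packaged: `FarRow` = the X-independent side conditions, `InRowBox` = the two slabs;
★★ `far_six_le_of_farRow` / `le_far_twelve_of_farRow`).  At the ideal point `detPar 0 = 3/4`, `detFull 0 = 1/2`,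
`M₆(0) = 4π·Z₄'·(3/4)^{3/2} = 0.0610325…` (direct far-layer lattice sum `0.0610298` + planar truncation `2.7·10⁻⁶` of that sum),
`M₁₂(0) = 1.18732·10⁻⁵`; the row remainders are `≲ 10⁻⁹` (memo NODE-g70 §2).  So the far field of BOTH models is an explicit ALGEBRAIC
function of the five chart variables — `∇M₆(0) = (0.0407, 0, −0.0407, 0, −0.1831)`, `‖∇M₆(0)‖ = 0.192` (the slope generation 69 had to
carry as jet data) — and the jet obligations of `…RadialJet` become inequalities between algebraic functions (`…RadialJetFar`).

Everything is stated over tree vocabulary (`layerTerm/layerSum`, `windowSixUp/windowTwelveLo`, `gramChart`, `chartScale`, `gramOfChart`,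
`DualRow`, `FarWindowData`); nothing is restated; no `sorry`, no new axioms.  Tags: ★/★★ this file · [formal bookkeeping] · [folklore].
-/

noncomputable section

open Set Module
open scoped Real InnerProductSpace

namespace Summit.AtomisticToContinuum.Crystallization.Theorems.OverbindingBudgetAffineFarLayerMain
open Literature.MathematicalPhysics.StatisticalMechanics Literature.Algebra.EuclideanLattices
  Literature.Analysis.FunctionSpaces
open Summit.AtomisticToContinuum.Crystallization.Theorems.OverbindingBudgetAffineFarSmoothSplit
open Summit.AtomisticToContinuum.Crystallization.Theorems.OverbindingBudgetAffineRadialChart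

local notation "E3" => EuclideanSpace ℝ (Fin 3)
local notation "E5" => EuclideanSpace ℝ (Fin 5)

/-! ## §1 The two Gram determinants of a chart point and the closed-form far main terms -/

/-- The PLANAR Gram determinant of a chart point: `det G_∥(y) = G₀₀G₁₁ − G₀₁² = (1 + y₂) − (½ + y₀)²` (`G₀₀ = 1` pinned). -/
def detPar (y : E5) : ℝ := (1 + y 2) - (1 / 2 + y 0) ^ 2

/-- The FULL Gram determinant of a chart point: `det G(y)`, cofactor expansion along the first row of
`G(y) = [[1, ½ + y₀, y₁], [½ + y₀, 1 + y₂, y₃], [y₁, y₃, ⅔ + y₄]]`. -/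
def detFull (y : E5) : ℝ :=
  ((1 + y 2) * (2 / 3 + y 4) - y 3 ^ 2) - (1 / 2 + y 0) * ((1 / 2 + y 0) * (2 / 3 + y 4) - y 3 * y 1) +
    y 1 * ((1 / 2 + y 0) * y 3 - (1 + y 2) * y 1)

/-- `Z₄' = ζ(4) − 1 − 2⁻⁴ − 3⁻⁴ = π⁴/90 − 1393/1296 = Σ_{m ≥ 4} m⁻⁴` — one half of `Σ_{|k| ≥ 4} k⁻⁴`. -/
def zetaFourTail : ℝ := π ^ 4 / 90 - 1393 / 1296

/-- The truncated tail `T_N = Σ_{m<N} (m+4)^{-10}` (a lower bound of `Σ_{m ≥ 4} m^{-10}` for every `N`). -/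
def tenTail (N : ℕ) : ℝ := ∑ m ∈ Finset.range N, ((((m + 4 : ℕ) : ℝ)) ^ 10)⁻¹

/-- ★ THE FAR MAIN TERM of `s⁶·T₃↑` in closed form:
`M₆(y) = π·Z₄'·det G_∥(y)² / (√(det G_∥(y))·det G(y)²)` (`= π·Z₄'·(det G_∥)^{3/2}/(det G)²`). -/
def farMainSix (y : E5) : ℝ := π * zetaFourTail * detPar y ^ 2 / (Real.sqrt (detPar y) * detFull y ^ 2)

/-- ★ THE FAR MAIN TERM of `s¹²·T₆↓` in closed form (tail truncated at `N` terms):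
`M₁₂(N, y) = (2π/5)·T_N·det G_∥(y)⁵/(√(det G_∥(y))·det G(y)⁵)` (`= (2π/5)·T_N·(det G_∥)^{9/2}/(det G)⁵`). -/
def farMainTwelve (N : ℕ) (y : E5) : ℝ := 2 * π / 5 * tenTail N * detPar y ^ 5 / (Real.sqrt (detPar y) * detFull y ^ 5)

/-- At the ideal hcp point: `det G_∥(0) = 3/4`. [formal bookkeeping] -/
theorem detPar_zero : detPar 0 = 3 / 4 := by
  simp [detPar]; norm_num

/-- At the ideal hcp point: `det G(0) = 1/2`. [formal bookkeeping] -/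
theorem detFull_zero : detFull 0 = 1 / 2 := by
  simp [detFull]; norm_num

/-- `Z₄'` IS the tail sum: `Σ_{m} (m+4)⁻⁴ = π⁴/90 − 1393/1296`. [Euler; Mathlib `hasSum_zeta_four`] -/
theorem hasSum_zetaFourTail : HasSum (fun m : ℕ => ((((m + 4 : ℕ) : ℝ)) ^ 4)⁻¹) zetaFourTail := by
  have h := (hasSum_nat_add_iff' (f := fun n : ℕ => 1 / (n : ℝ) ^ 4) 4).2 hasSum_zeta_four
  simp only [Finset.sum_range_succ, Finset.sum_range_zero, Nat.cast_zero, Nat.cast_one, Nat.cast_ofNat,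
    one_div] at h
  have e : π ^ 4 / 90 - (0 + ((0 : ℝ) ^ 4)⁻¹ + ((1 : ℝ) ^ 4)⁻¹ + ((2 : ℝ) ^ 4)⁻¹ + ((3 : ℝ) ^ 4)⁻¹) = zetaFourTail := by
    unfold zetaFourTail; norm_num
  rwa [e] at h

/-- Twenty-digit enclosure of `Z₄'`: `0.00747755469 ≤ Z₄' ≤ 0.0074775547`. [formal bookkeeping; Mathlib `Real.pi_gt_d20`] -/
theorem zetaFourTail_mem_Icc : (747755469 / 10 ^ 11 : ℝ) ≤ zetaFourTail ∧ zetaFourTail ≤ 74775547 / 10 ^ 10 := by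
  have h1 := Real.pi_gt_d20
  have h2 := Real.pi_lt_d20
  have h0 : (0 : ℝ) < π := Real.pi_pos
  unfold zetaFourTail
  constructor
  · nlinarith [pow_le_pow_left₀ (by norm_num : (0:ℝ) ≤ 3.14159265358979323846) h1.le 4]
  · nlinarith [pow_le_pow_left₀ h0.le h2.le 4]

/-- `0 < Z₄'`. [formal bookkeeping] -/
theorem zetaFourTail_pos : 0 < zetaFourTail := by
  have h := zetaFourTail_mem_Icc.1; linarith

/-- `0 ≤ T_N`. [formal bookkeeping] -/
theorem tenTail_nonneg (N : ℕ) : 0 ≤ tenTail N := Finset.sum_nonneg fun m _ => by positivity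

/-- `M₆ > 0` wherever both determinants are positive. [formal bookkeeping] -/
theorem farMainSix_pos {y : E5} (hq : 0 < detPar y) (hc : 0 < detFull y) : 0 < farMainSix y := by
  unfold farMainSix
  have := zetaFourTail_pos
  have := Real.sqrt_pos.2 hq
  positivity

/-! ## §2 Homogeneity of the layer sums under rescaling of the linear part -/

section Homogeneity

variable {c : ℝ} (hc : 0 < c) (w : Fin 6 → ℤ) (X : E3 →ₗ[ℝ] E3) (n : ℕ)
include hc

/-- `layerTerm (c•X) n = c⁻ⁿ · layerTerm X n`. [formal bookkeeping] -/
theorem layerTerm_smul (k o : ℤ) (ij : ℤ × ℤ) : layerTerm (c • X) n k o ij = (c ^ n)⁻¹ * layerTerm X n k o ij := by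
  unfold layerTerm
  rw [LinearMap.smul_apply, norm_smul, Real.norm_eq_abs, abs_of_pos hc, mul_inv, mul_pow, ← inv_pow]

/-- `layerSum (c•X) n k o = c⁻ⁿ · layerSum X n k o`. [formal bookkeeping] -/
theorem layerSum_smul (k o : ℤ) : layerSum (c • X) n k o = (c ^ n)⁻¹ * layerSum X n k o := by
  unfold layerSum
  rw [← tsum_mul_left]
  exact tsum_congr fun ij => layerTerm_smul hc X n k o ij

/-- `layerUp w (c•X) n k = c⁻ⁿ · layerUp w X n k`. [formal bookkeeping] -/
theorem layerUp_smul (k : ℤ) : layerUp w (c • X) n k = (c ^ n)⁻¹ * layerUp w X n k := by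
  have h0 : 0 ≤ (c ^ n)⁻¹ := by positivity
  unfold layerUp
  split_ifs <;> simp only [layerSum_smul hc, mul_max_of_nonneg _ _ h0]

/-- `layerLo w (c•X) n k = c⁻ⁿ · layerLo w X n k`. [formal bookkeeping] -/
theorem layerLo_smul (k : ℤ) : layerLo w (c • X) n k = (c ^ n)⁻¹ * layerLo w X n k := by
  have h0 : 0 ≤ (c ^ n)⁻¹ := by positivity
  unfold layerLo
  split_ifs <;> simp only [layerSum_smul hc, mul_min_of_nonneg _ _ h0]

/-- `T₃↑(w, c•X) = c⁻⁶ · T₃↑(w, X)`. [formal bookkeeping] -/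
theorem windowSixUp_smul : windowSixUp w (c • X) = (c ^ 6)⁻¹ * windowSixUp w X := by
  unfold windowSixUp
  rw [← tsum_mul_left]
  exact tsum_congr fun k => layerUp_smul hc w X 6 k

/-- `T₆↓(w, c•X) = c⁻¹² · T₆↓(w, X)`. [formal bookkeeping] -/
theorem windowTwelveLo_smul : windowTwelveLo w (c • X) = (c ^ 12)⁻¹ * windowTwelveLo w X := by
  unfold windowTwelveLo
  rw [← tsum_mul_left]
  exact tsum_congr fun k => layerLo_smul hc w X 12 k

end Homogeneity

/-! ## §3 The scale-normalised map and its Gram data: the X-dictionary of the two determinants -/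

/-- The SCALE-NORMALISED linear part `X̂ = (chartScale X)⁻¹ • X` (so `‖X̂ b₀‖ = 1`). -/
def unitMap (X : E3 →ₗ[ℝ] E3) : E3 →ₗ[ℝ] E3 := (chartScale X)⁻¹ • X

/-- `unitMap_apply` (docstring added by the landing lane; see the module docstring). [formal bookkeeping] -/
theorem unitMap_apply (X : E3 →ₗ[ℝ] E3) (v : E3) : unitMap X v = (chartScale X)⁻¹ • X v := rfl

/-- `b₀ = t₁`. [formal bookkeeping] -/
theorem redBasis_zero : redBasis 0 = triangularVec₁ 1 := by
  simp [redBasis, OverbindingBudgetAffineFarSmoothSplit.layerVec, Literature.MathematicalPhysics.StatisticalMechanics.layerVec]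

/-- `b₁ = t₂`. [formal bookkeeping] -/
theorem redBasis_one : redBasis 1 = triangularVec₂ 1 := by
  simp [redBasis, OverbindingBudgetAffineFarSmoothSplit.layerVec, Literature.MathematicalPhysics.StatisticalMechanics.layerVec]

/-- `b₂ = √(2/3)·e₃`. [formal bookkeeping] -/
theorem redBasis_two : redBasis 2 = layerNormal (Real.sqrt (2 / 3)) := by
  simp [redBasis, OverbindingBudgetAffineFarSmoothSplit.layerVec, Literature.MathematicalPhysics.StatisticalMechanics.layerVec]

/-- ★ The Gram matrix of `X̂` in the reduced basis IS the chart matrix: `⟪X̂ bₐ, X̂ b_b⟫ = G(gramChart X)ₐ_b`. [this file] -/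
theorem inner_unitMap_redBasis {X : E3 →ₗ[ℝ] E3} (hs : chartScale X ≠ 0) (a b : Fin 3) :
    ⟪unitMap X (redBasis a), unitMap X (redBasis b)⟫_ℝ = gramOfChart (gramChart X) a b := by
  have h := gramOfChart_gramChart hs a b
  unfold gramEntry at h
  rw [unitMap_apply, unitMap_apply, real_inner_smul_left, real_inner_smul_right, ← h]
  field_simp

section Dictionary

variable {X : E3 →ₗ[ℝ] E3} (hs : chartScale X ≠ 0)
include hs

/-- `‖X̂ t₁‖² = 1`. [this file] -/
theorem normSq_unit_t₁ : ‖unitMap X (triangularVec₁ 1)‖ ^ 2 = 1 := by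
  rw [← real_inner_self_eq_norm_sq, ← redBasis_zero, inner_unitMap_redBasis hs]
  simp [gramOfChart]

/-- `⟪X̂ t₁, X̂ t₂⟫ = ½ + y₀`. [this file] -/
theorem inner_unit_t₁_t₂ :
    ⟪unitMap X (triangularVec₁ 1), unitMap X (triangularVec₂ 1)⟫_ℝ = 1 / 2 + gramChart X 0 := by
  rw [← redBasis_zero, ← redBasis_one, inner_unitMap_redBasis hs]
  simp [gramOfChart]

/-- `‖X̂ t₂‖² = 1 + y₂`. [this file] -/
theorem normSq_unit_t₂ : ‖unitMap X (triangularVec₂ 1)‖ ^ 2 = 1 + gramChart X 2 := by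
  rw [← real_inner_self_eq_norm_sq, ← redBasis_one, inner_unitMap_redBasis hs]
  simp [gramOfChart]

/-- `⟪X̂ t₁, X̂ (√(2/3)e₃)⟫ = y₁`. [this file] -/
theorem inner_unit_t₁_n :
    ⟪unitMap X (triangularVec₁ 1), unitMap X (layerNormal (Real.sqrt (2 / 3)))⟫_ℝ = gramChart X 1 := by
  rw [← redBasis_zero, ← redBasis_two, inner_unitMap_redBasis hs]
  simp [gramOfChart]

/-- `⟪X̂ t₂, X̂ (√(2/3)e₃)⟫ = y₃`. [this file] -/
theorem inner_unit_t₂_n :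
    ⟪unitMap X (triangularVec₂ 1), unitMap X (layerNormal (Real.sqrt (2 / 3)))⟫_ℝ = gramChart X 3 := by
  rw [← redBasis_one, ← redBasis_two, inner_unitMap_redBasis hs]
  simp [gramOfChart]

/-- `‖X̂ (√(2/3)e₃)‖² = ⅔ + y₄`. [this file] -/
theorem normSq_unit_n : ‖unitMap X (layerNormal (Real.sqrt (2 / 3)))‖ ^ 2 = 2 / 3 + gramChart X 4 := by
  rw [← real_inner_self_eq_norm_sq, ← redBasis_two, inner_unitMap_redBasis hs]
  simp [gramOfChart]

/-- ★ The planar Gram determinant of `X̂` IS `det G_∥(gramChart X)`. [this file] -/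
theorem gramDet_unit_eq_detPar :
    ‖unitMap X (triangularVec₁ 1)‖ ^ 2 * ‖unitMap X (triangularVec₂ 1)‖ ^ 2 -
        ⟪unitMap X (triangularVec₁ 1), unitMap X (triangularVec₂ 1)⟫_ℝ ^ 2 = detPar (gramChart X) := by
  rw [normSq_unit_t₁ hs, normSq_unit_t₂ hs, inner_unit_t₁_t₂ hs]
  unfold detPar; ring

end Dictionary

/-- ★ **Squared height times planar Gram determinant = full Gram determinant** (any three vectors `u, v, z` of `E3`;
`height = dist(z, span{u, v})`): `dist(z, span{u,v})² · (‖u‖²‖v‖² − ⟪u,v⟫²) = det Gram(u, v, z)`. [folklore] -/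
theorem heightSq_mul_gramDet₂ (u v z : E3) :
    ‖z - (Submodule.span ℝ (Set.range ![u, v])).starProjection z‖ ^ 2 * (‖u‖ ^ 2 * ‖v‖ ^ 2 - ⟪u, v⟫_ℝ ^ 2) =
      ‖u‖ ^ 2 * (‖v‖ ^ 2 * ‖z‖ ^ 2 - ⟪v, z⟫_ℝ ^ 2) - ⟪u, v⟫_ℝ * (⟪u, v⟫_ℝ * ‖z‖ ^ 2 - ⟪v, z⟫_ℝ * ⟪u, z⟫_ℝ) +
        ⟪u, z⟫_ℝ * (⟪u, v⟫_ℝ * ⟪v, z⟫_ℝ - ‖v‖ ^ 2 * ⟪u, z⟫_ℝ) := by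
  have hpW := (Submodule.span ℝ (Set.range ![u, v])).starProjection_apply_mem z
  have hw := (Submodule.span ℝ (Set.range ![u, v])).sub_starProjection_mem_orthogonal z
  have huW : u ∈ Submodule.span ℝ (Set.range ![u, v]) := Submodule.subset_span ⟨0, rfl⟩
  have hvW : v ∈ Submodule.span ℝ (Set.range ![u, v]) := Submodule.subset_span ⟨1, rfl⟩
  have hu0 := Submodule.inner_right_of_mem_orthogonal huW hw
  have hv0 := Submodule.inner_right_of_mem_orthogonal hvW hw
  obtain ⟨cf, hcf⟩ := (Submodule.mem_span_range_iff_exists_fun ℝ).1 hpW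
  simp only [Fin.sum_univ_two, Matrix.cons_val_zero, Matrix.cons_val_one] at hcf
  generalize hp : (Submodule.span ℝ (Set.range ![u, v])).starProjection z = p at hcf hu0 hv0 ⊢
  have hz : z = cf 0 • u + cf 1 • v + (z - p) := by rw [hcf]; abel
  generalize z - p = q at hz hu0 hv0 ⊢
  subst hz
  have hu0' : ⟪q, u⟫_ℝ = 0 := by rw [real_inner_comm]; exact hu0
  have hv0' : ⟪q, v⟫_ℝ = 0 := by rw [real_inner_comm]; exact hv0
  have hvu : ⟪v, u⟫_ℝ = ⟪u, v⟫_ℝ := real_inner_comm _ _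
  simp only [← real_inner_self_eq_norm_sq, inner_add_left, inner_add_right, real_inner_smul_left,
    real_inner_smul_right, hu0, hv0, hu0', hv0', hvu]
  ring

/-- ★ The X-dictionary of the FULL determinant: for the normalised map, `height(X̂)² · det G_∥(y) = det G(y)`,
`y = gramChart X`, where `height(X̂) = dist(X̂(√(2/3)e₃), span{X̂ t₁, X̂ t₂})` is the unit layer height of `X̂`. [this file] -/
theorem heightSq_unit_mul_detPar {X : E3 →ₗ[ℝ] E3} (hs : chartScale X ≠ 0) :
    ‖unitMap X (layerNormal (Real.sqrt (2 / 3))) - (Submodule.span ℝ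
        (Set.range ![unitMap X (triangularVec₁ 1), unitMap X (triangularVec₂ 1)])).starProjection
          (unitMap X (layerNormal (Real.sqrt (2 / 3))))‖ ^ 2 * detPar (gramChart X) = detFull (gramChart X) := by
  have h := heightSq_mul_gramDet₂ (unitMap X (triangularVec₁ 1)) (unitMap X (triangularVec₂ 1))
    (unitMap X (layerNormal (Real.sqrt (2 / 3))))
  rw [normSq_unit_t₁ hs, normSq_unit_t₂ hs, inner_unit_t₁_t₂ hs, normSq_unit_n hs, inner_unit_t₁_n hs,
    inner_unit_t₂_n hs] at h
  unfold detPar detFull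
  linear_combination h

/-- Admissible linear parts are injective (near-isometry clause with `3θ = 3/25 < 1`). [this file] -/
theorem injective_of_farWindowData {θ' : ℝ} {w : Fin 6 → ℤ} {X : E3 →ₗ[ℝ] E3}
    (hX : FarWindowData (1 / 25) θ' w X) : Function.Injective X := by
  intro a b hab
  have h := (norm_bounds_of_nearIsometry hX.2.1 (a - b)).1
  rw [map_sub, hab, sub_self, norm_zero] at h
  have h' : ‖a - b‖ ≤ 0 := by linarith
  exact sub_eq_zero.1 (norm_le_zero_iff.1 h')

/-- … hence so is the normalised map. [formal bookkeeping] -/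
theorem injective_unitMap {θ' : ℝ} {w : Fin 6 → ℤ} {X : E3 →ₗ[ℝ] E3}
    (hX : FarWindowData (1 / 25) θ' w X) : Function.Injective (unitMap X) := by
  have hs : 0 < chartScale X := scale_pos_of_farWindowData (by norm_num) hX
  intro a b hab
  rw [unitMap_apply, unitMap_apply] at hab
  exact injective_of_farWindowData hX (smul_right_injective E3 (inv_ne_zero hs.ne') hab)

end Summit.AtomisticToContinuum.Crystallization.Theorems.OverbindingBudgetAffineFarLayerMain

end
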